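import Literature.NumberTheory.EllipticCurves.IsogenyFrobeniusTraceProofs
import Literature.NumberTheory.EllipticCurves.IsogenyGroundFieldExtension
import Literature.NumberTheory.EllipticCurves.ShafarevichGoodReductionBadPlacesProofs
import Literature.NumberTheory.EllipticCurves.IsogenyDualProofs
import Literature.NumberTheory.EllipticCurves.Delbourgo2002.PAdicBSDLeadingTerm
import HarnessLib

/-!
# `#Ẽ_v(k_v)` is an ISOGENY invariant over every number field; hence Delbourgo's
# `ReductionNonAnomalous W p` — the anomalous bit of the (G)-cell — is a `ℚ`-isogeny-CLASS invariant

HONEST FRAMING (cell `b2b-bsdres`, run/shared/lean/b2b/bsd-rank1-residual/, verbatim in every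
file): the goal of the cell is to DELETE the COMBINATION-SHAPED residual classes of the
Birch–Swinnerton-Dyer formula for ALL analytic-rank `≤ 1` elliptic curves over `ℚ` — "full BSD
formula for every rank `≤ 1` curve in class `C`" assembled STRICTLY from published theorems — so
that the rank-`≤ 1` remainder becomes exactly the CONSTRUCTION-SHAPED classes, which are TYPED
(missing-input `Prop`s), NOT attempted. This is not "finishing BSD". Sub-cell `additive-p2`
(X3♯(G-ord) / X4♯(G-ord)), generation 38: research route; no claim beyond the stated classes;
TOOL theorems, no definition, no named fact, nothing booked, no label moved.

## What and why

Generation 15 (`Additive/GordIsogenyInvariance`) proved that the cell's predicates `TypeG`,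
`TypeGOrd`, the defect `e`, `SubGord`, `ClassX3Gord/ClassX4Gord` are `ℚ`-isogeny-class invariants;
generation 36 (`Additive/ReductionPointCountBaseChange`) proved that `#Ẽ_w(k_w)` is invariant
under BASE CHANGE at equal residue fields.  The one invariance the anomalous-bit dictionary of
gens 34–36 still lacked is invariance under ISOGENY: the census reads Delbourgo's
`ReductionNonAnomalous W p` on Cremona's optimal curve and uses it for the class (generation 38's
evidence: the 113 classes of the whole table with a `p`-torsion member have EVERY (G)-member on
the anomalous residue).  This file supplies it from the tree's Tate-module theorems:

* **`frobeniusTraceAt_eq_of_isIsogenous`** — over ANY number field `K`: `W ∼ W'` (`K`-isogenous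
  elliptic curves), `v` a finite place good for both ⟹ `a_v(W) = a_v(W')`
  (`frobeniusTraceAt`: `q_v + 1 − #Ẽ_v(k_v)` of the chosen local minimal models).  Proof = the
  tree's `frobeniusTrace_eq_of_isIsogenous` (stated there for `K = ℚ` and the prime-indexed
  `frobeniusTrace`) run over `K`: an auxiliary prime `ℓ ∉ v` (one of `2`, `3`), a prime `𝔓 ∣ v`
  of `\bar ℤ_K` with an arithmetic Frobenius `σ` (`exists_isArithFrobAt_of_mem_primesAbove_holds`),
  `tr(σ | T_ℓ W) = tr(σ | T_ℓ W')` (`IsIsogenous.trace_galoisRepTate_eq`, Faltings Kor. 2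
  (ii)⇒(iv)) and `tr(σ | T_ℓ W) = a_v` (`trace_galoisRepTate_frobenius_of_hasGoodReductionAt_holds`,
  *AEC* C.21.3);
* **`natCard_point_reductionAt_eq_of_isIsogenous`** — hence `#Ẽ_v(W)(k_v) = #Ẽ_v(W')(k_v)`;
* **`reductionNonAnomalous_iff_of_isIsogenous`** — for `W ∼ W'` over `ℚ` and any prime `p`:
  `ReductionNonAnomalous W p ↔ ReductionNonAnomalous W' p` (the isogeny extends to every (G)-field
  `F`, `IsIsogenous.extendScalars`; good places agree, *AEC* VII.7.2; point counts agree).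

Consumers: `Additive/GordTorsionAnomalousClass` (generation 38: a `p`-torsion point on ANY curve of
the class makes the class anomalous); every `ℓ = 1` statement of the cell that reads the residue
on the optimal curve.

References: [Faltings1983Endlichkeit] G. Faltings, Invent. Math. 73 (1983), §5 Korollar 2;
[SilvermanAEC2009] J. H. Silverman, *AEC* 2nd ed., III.§4, Cor. VII.7.2, C.§16, C.21 Remark 21.3;
[Delbourgo2002] D. Delbourgo, J. Number Theory 95 (2002), p. 39 (`ℓ_p(E)`).
-/

noncomputable section

open scoped Classical NumberField

namespace Summit.BirchSwinnertonDyer.Rank1Residual.Additive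

open WeierstrassCurve IsDedekindDomain NumberField Literature.NumberTheory.EllipticCurves

universe u

/-! ## §1 Over a number field: `a_v` and `#Ẽ_v(k_v)` along an isogeny -/

section NumberField

variable {K : Type u} [Field K] [NumberField K]

variable {W W' : WeierstrassCurve K} [W.IsElliptic] [W'.IsElliptic]

/-- **`K`-isogenous elliptic curves over a number field have the same trace of Frobenius at every
finite place good for both**: `a_v(W) = a_v(W')` (`frobeniusTraceAt`). Faltings' Korollar 2,
(i) ⇒ (iv), for elliptic curves over `K`; classically *AEC* Exercise 5.4(a) with C.21.3. The tree's
`frobeniusTrace_eq_of_isIsogenous` is the case `K = ℚ`; the proof is the same (auxiliary `ℓ ∉ v`,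
arithmetic Frobenius at `𝔓 ∣ v`, equal Tate-module traces).
[cite: Faltings1983Endlichkeit, §5 Korollar 2, (i) ⇒ (iv); SilvermanAEC2009, C.21 Remark 21.3] -/
theorem frobeniusTraceAt_eq_of_isIsogenous (h : IsIsogenous W W') (v : HeightOneSpectrum (𝓞 K))
    (hv : W.HasGoodReductionAt v) (hv' : W'.HasGoodReductionAt v) :
    W.frobeniusTraceAt v = W'.frobeniusTraceAt v := by
  -- an auxiliary rational prime `ℓ ∉ v`: one of `2`, `3` (their difference is `1`); this is the
  -- tree's `Literature.NumberTheory.Automorphic.exists_prime_natCast_not_mem_asIdeal`, inlined to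
  -- keep the potential-modularity sweep out of the import closure
  obtain ⟨ℓ, hℓ, hℓv⟩ : ∃ ℓ : ℕ, ℓ.Prime ∧ (ℓ : 𝓞 K) ∉ v.asIdeal := by
    by_cases h2 : ((2 : ℕ) : 𝓞 K) ∈ v.asIdeal
    · refine ⟨3, Nat.prime_three, fun h3 => ?_⟩
      have h1 : (1 : 𝓞 K) ∈ v.asIdeal := by
        have h := v.asIdeal.sub_mem h3 h2
        have e : ((3 : ℕ) : 𝓞 K) - ((2 : ℕ) : 𝓞 K) = 1 := by push_cast; norm_num
        rwa [e] at h
      exact v.isPrime.ne_top ((Ideal.eq_top_iff_one _).mpr h1)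
    · exact ⟨2, Nat.prime_two, h2⟩
  haveI := Fact.mk hℓ
  obtain ⟨𝔓, h𝔓⟩ := HeightOneSpectrum.primesAbove_nonempty v
  obtain ⟨σ, hσ⟩ := HeightOneSpectrum.exists_isArithFrobAt_of_mem_primesAbove_holds h𝔓
  have key := h.trace_galoisRepTate_eq ℓ (by exact_mod_cast hℓ.ne_zero) σ
  rw [W.trace_galoisRepTate_frobenius_of_hasGoodReductionAt_holds ℓ v hℓv hv h𝔓 hσ,
    W'.trace_galoisRepTate_frobenius_of_hasGoodReductionAt_holds ℓ v hℓv hv' h𝔓 hσ] at key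
  exact_mod_cast key

/-- **`#Ẽ_v(k_v)` is an isogeny invariant**: for `K`-isogenous elliptic curves over a number field
and a finite place `v` good for both, the reductions of the chosen local minimal models have the
same number of `k_v`-points. [cite: Faltings1983Endlichkeit, §5 Korollar 2, (i) ⇒ (iv); SilvermanAEC2009, C.§16] -/
theorem natCard_point_reductionAt_eq_of_isIsogenous (h : IsIsogenous W W')
    (v : HeightOneSpectrum (𝓞 K)) (hv : W.HasGoodReductionAt v) (hv' : W'.HasGoodReductionAt v) :
    Nat.card (W.reductionAt v).toAffine.Point = Nat.card (W'.reductionAt v).toAffine.Point := by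
  have e := frobeniusTraceAt_eq_of_isIsogenous h v hv hv'
  rw [frobeniusTraceAt_def, frobeniusTraceAt_def] at e
  omega

/-- Divisibility form: `p ∣ #Ẽ_v(W) ↔ p ∣ #Ẽ_v(W')` for `W ∼ W'`, `v` good for both.
[cite: Faltings1983Endlichkeit, §5 Korollar 2, (i) ⇒ (iv)] -/
theorem dvd_natCard_point_reductionAt_iff_of_isIsogenous (h : IsIsogenous W W')
    (v : HeightOneSpectrum (𝓞 K)) (hv : W.HasGoodReductionAt v) (hv' : W'.HasGoodReductionAt v)
    (n : ℕ) :
    n ∣ Nat.card (W.reductionAt v).toAffine.Point ↔ n ∣ Nat.card (W'.reductionAt v).toAffine.Point := by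
  rw [natCard_point_reductionAt_eq_of_isIsogenous h v hv hv']

end NumberField

/-! ## §2 Over `ℚ`: `ReductionNonAnomalous` is a `ℚ`-isogeny-class invariant -/

section Rat

variable {W W' : WeierstrassCurve ℚ} [W.IsElliptic] [W'.IsElliptic] (p : ℕ) [hp : Fact p.Prime]

/-- One direction: `W ∼ W'`, `ReductionNonAnomalous W' p` ⟹ `ReductionNonAnomalous W p` (the
`ℚ`-isogeny extends to every subfield `F` of a `p`-th cyclotomic field, good places of `W_F`, `W'_F`
agree, point counts agree). [cite: Delbourgo2002, p. 39 (definition of ℓ_p(E)); SilvermanAEC2009, Cor. VII.7.2] -/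
theorem reductionNonAnomalous_of_isIsogenous (h : IsIsogenous W W')
    (hR : Delbourgo2002.ReductionNonAnomalous W' p) : Delbourgo2002.ReductionNonAnomalous W p := by
  intro L _ _ _ F w hw hgood
  haveI : NumberField F := NumberField.of_module_finite ℚ F
  haveI : (W.baseChange F).IsElliptic := by rw [baseChange]; infer_instance
  haveI : (W'.baseChange F).IsElliptic := by rw [baseChange]; infer_instance
  have hF : IsIsogenous (W.baseChange F) (W'.baseChange F) := h.extendScalars F
  have hgood' : (W'.baseChange F).HasGoodReductionAt w :=
    (hF.hasGoodReductionAt_iff_of_isIsogenous w).mp hgood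
  rw [dvd_natCard_point_reductionAt_iff_of_isIsogenous hF w hgood hgood']
  exact hR L F w hw hgood'

/-- **`ReductionNonAnomalous W p ↔ ReductionNonAnomalous W' p` for `ℚ`-isogenous `W ∼ W'`** (any
prime `p`): the anomalous bit of Delbourgo's `ℓ_p(E)` — decided on the (G)-cell by one residue of
Cremona's `(c₄, c₆)` (gens 34–36) — is a `ℚ`-isogeny-CLASS invariant, so it may be read on any
member (the census reads the optimal curve). [cite: Delbourgo2002, p. 39 (definition of ℓ_p(E)); Faltings1983Endlichkeit, §5 Korollar 2] -/
theorem reductionNonAnomalous_iff_of_isIsogenous (h : IsIsogenous W W') :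
    Delbourgo2002.ReductionNonAnomalous W p ↔ Delbourgo2002.ReductionNonAnomalous W' p :=
  ⟨fun hR => reductionNonAnomalous_of_isIsogenous p h.symm_of_charZero hR,
    fun hR => reductionNonAnomalous_of_isIsogenous p h hR⟩

end Rat

end Summit.BirchSwinnertonDyer.Rank1Residual.Additive

end
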